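import Mathlib.Probability.ProbabilityMassFunction.Constructions
import Mathlib.Probability.Moments.SubGaussian
import Mathlib.Probability.Independence.Basic
import Literature.InformationTheory.QuantumLearning.TwoCopyBellSampling
import Literature.InformationTheory.QuantumLearning.DirectFidelityEstimation
import Literature.Computability.Cryptography.PolyTimeComputableRealsSqrt
import HarnessLib

/-!
# Two-copy Bell sampling: sample complexity of the `|Tr(Pρ)|²` estimator (Hoeffding step)

Topic `Literature/InformationTheory/QuantumLearning`, SEQUEL of `TwoCopyBellSampling.lean` (the
exact identity `Σ_b ε(a,b) Tr(Φ_b(ρ⊗ρ)) = |Tr(P_aρ)|²` behind Bell measurements on two copies).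
Here: the finite-sample statement printed next to it by Huang–Kueng–Preskill, PRL **126**, 190505
(2021), SM §*Measuring absolute values*, and by Huang et al., Science **376**, 1182 (2022), SM
§*Prediction phase*:

"For each Pauli observable `P = σ_1 ⊗ … ⊗ σ_n`, we define the corresponding expression
`â(P) = (1/N₁) Σ_{t=1}^{N₁} ∏_{k=1}^n Tr((σ_k ⊗ σ_k) S_k^{(t)})` … Using the statistical property
given in Equation (bell-expected), we can apply Hoeffding's inequality to show that, with high
probability, the estimate `â(P)` is close to the expectation value `|Tr(Pρ)|²`:
**Lemma 3.** Given `N₁ = Θ(log(1/δ)/ε²)`. For any Pauli operator `P`, we have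
`|â(P) − |Tr(Pρ)|²| ≤ ε` with probability at least `1 − δ`."
[cite: HuangKuengPreskill2021, SM §'Measuring absolute values', Lemma 3]
[cite: HuangEtAl2022Science, SM §'Prediction phase', Lemma 1 (N_Q = Θ(log(1/δ)/ε²))]

## Contents (all proved, 0 named facts)

* `sum_weight_abs_sum_sub_gt_le` — **two-sided Hoeffding for the empirical sum of a `[−1,1]`-valued
  statistic of `T` i.i.d. draws from a finite distribution**, in the measure-free form of the tree's
  `XEBSampleComplexity.lean`: for probability weights `w` on a finite `α`, `|F| ≤ 1`, every `T` and
  `a ≥ 0`, the product weight of the sequences `ω : Fin T → α` with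
  `|Σ_i F(ω_i) − T·E_w[F]| > a` is at most `2 exp(−a²/(2T))`.  Proof: Mathlib's Hoeffding lemma
  (`hasSubgaussianMGF_of_mem_Icc`: a `[−1,1]`-valued variable is sub-Gaussian with parameter `1`)
  and its Chernoff bound for independent sums (`HasSubgaussianMGF.measure_sum_ge_le_of_iIndepFun`)
  under `Measure.pi` of `PMF.toMeasure w` (independence of the coordinates: `iIndepFun_pi`), on
  both tails; the product measure of a finite set of sequences is read off `Measure.pi_singleton`.
  The STATEMENT is a finite sum — no measure in it.
* The Bell-sampling instance: `conjTranspose_bellState` / `conjTranspose_bellBasis` (the Bell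
  projectors are Hermitian), `star_trace_bellBasis_mul`, `bellWeight ρ b = Re Tr(Φ_b(ρ⊗ρ))` (the
  outcome law, real for Hermitian `ρ`: `trace_bellBasis_two_copies_im`), `bellSignℝ a b = ε(a,b) ∈ {±1}` as a real
  number, `sum_bellWeight` (`Σ_b w_b = (Re Tr ρ)²`, `= 1` for a state),
  **`sum_bellSignℝ_mul_bellWeight`** (`E_w[ε(a,·)] = (Re Tr(P_aρ))² = |Tr(P_aρ)|²` — the
  real form of (bell-expected)), and **`bellEstimate_tail`** (Lemma 3 as a tail bound): for a
  Hermitian trace-one `ρ` with nonnegative Bell weights, every Pauli string `a`, every `N`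
  and `ε ≥ 0`, the weight of the `N`-outcome records with `|â(a) − |Tr(P_aρ)|²| > ε`
  (`â(a) = (1/N)Σ_t ε(a, b_t)`) is at most `2 exp(−Nε²/2)`, and **`bellEstimate_tail_state`** (the
  same for a density matrix `ρ ⪰ 0`, `Tr ρ = 1`, the weights being nonnegative by
  `trace_bellBasis_mul_kronecker_nonneg` — `bellWeight_nonneg`); `bellEstimate_tail_le_delta_iff`
  reads the printed `N = Θ(log(1/δ)/ε²)`: the bound is `≤ δ` as soon as `N ≥ 2 log(2/δ)/ε²` (the
  tree's `DFE.settings_hoeffding` with `α = 1`).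

* Corollary 1's deterministic step (with the tree's `abs_sqrt_sub_sqrt_le`, `|√u − √v| ≤ √|u − v|`,
  of `PolyTimeComputableRealsSqrt.lean`): **`abs_sqrt_max_sub_abs_le`** (`|â − x²| ≤ ε ⟹ |√max(0,â) − |x|| ≤ √ε`: the estimate
  `b̂ = √max(0, â)` of `|Tr(Pρ)|` is `√ε`-accurate, hence `ε`-accurate from `N₁ = Θ(log(1/δ)/ε⁴)`).

* **All `M` observables at once** (SM §*Sample complexity analysis*: "following Corollary 1 and
  the union bound, we choose `N₁ = Θ(log(M/δ)/ε⁴)` such that with probability at least `1 − δ/2`,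
  we have `|b̂_i − |Tr(P_iρ)|| ≤ ε/3, ∀ i = 1, …, M`"): `sum_filter_exists_mem_le` (union bound for
  nonnegative weights over a finite family of events), **`bellEstimate_tail_union`** /
  `bellEstimate_tail_union_state` (for a finite set `A` of `M` Pauli strings the weight of the
  records on which SOME `a ∈ A` has `|â(a) − |Tr(P_aρ)|²| > ε` is `≤ M·2exp(−Nε²/2)`; `A = univ`
  is the all-`4ⁿ`-strings case), `bellEstimate_tail_union_le_delta_iff` (`≤ δ ⟺ N ≥ 2log(2M/δ)/ε²`),
  **`bellAbsEstimate_tail_union_state`** (the moduli: SOME `|b̂(a) − |Tr(P_aρ)|| > √ε` has weight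
  `≤ M·2exp(−Nε²/2)`, `N ≥ 1`) and `bellAbsEstimate_count` (accuracy `η` for all `M` moduli:
  `≤ δ ⟺ N ≥ 2log(2M/δ)/η⁴` — the printed `N₁ = Θ(log(M/δ)/ε⁴)`);
  `norm_trace_pauliString_mul_eq_abs_re` (`|Tr(P_aρ)| = |Re Tr(P_aρ)|` for Hermitian `ρ`).

Not covered: the sign-estimation stage with quantum memory (SM §*Measuring signs*, the quantum
union bound) and the lower bounds for single-copy strategies.

(pub-qadeq lane context — CLAIMS rows E-53 / E-54 and harvest-1 A-34: with `TwoCopyBellSampling.lean`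
this closes the quantitative half of "Bell measurements on `Θ(log(1/δ)/ε²)` pairs of copies predict
every `|Tr(Pρ)|` to `±ε`": the per-string Hoeffding step is a tree theorem.  HONEST FRAMING:
instance-level adjudication of specific advantage claims; no claim about BQP vs BPP or the summit —
a finite-sample inequality about a finite distribution, nothing about any device.)

## References

* H.-Y. Huang, R. Kueng, J. Preskill, PRL **126**, 190505 (2021), arXiv:2101.02464 — SM §*Measuring
  absolute values*, the estimator `â(P)` and Lemma 3.  [HuangKuengPreskill2021]
* H.-Y. Huang et al., Science **376**, 1182 (2022), arXiv:2112.00778 — SM §*Prediction phase*,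
  `â(O)` and Lemma 1.  [HuangEtAl2022Science]
* W. Hoeffding, J. Amer. Statist. Assoc. **58** (1963) 13–30, Thm. 2 (via Mathlib
  `ProbabilityTheory.hasSubgaussianMGF_of_mem_Icc`, `HasSubgaussianMGF.measure_sum_ge_le_of_iIndepFun`).
* Tree: `TwoCopyBellSampling.lean` (`bellSign_eq_one_or`, `sum_bellSign_mul_trace_bellBasis_two_copies`,
  `star_trace_pauliString_mul`, `sum_trace_bellBasis_mul_kronecker`, `trace_bellBasis_mul_kronecker_nonneg`),
  `XEBSampleComplexity.lean` (the `PMF.toMeasure` / `Measure.pi` pattern), `DirectFidelityEstimation.lean`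
  (`settings_hoeffding`), `PolyTimeComputableRealsSqrt.lean` (`abs_sqrt_sub_sqrt_le`).
-/

noncomputable section

open Matrix Finset
open MeasureTheory ProbabilityTheory
open scoped Kronecker NNReal ComplexOrder

namespace Literature.InformationTheory.QuantumLearning.BellSampling

open Literature.Computability.QuantumComplexity
open Literature.Computability.QuantumComplexity.PauliPath
open Literature.Computability.QuantumComplexity.OTOC
open Literature.InformationTheory.QuantumLearning.PauliChannelEstimation

/-! ### Hoeffding for the empirical sum of a bounded statistic of i.i.d. draws (finite form) -/

section Hoeffding

variable {α : Type*} [Fintype α]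

/-- **Two-sided Hoeffding bound, finite i.i.d. form.**  For probability weights `w` on a finite type,
a statistic `|F| ≤ 1`, a number of draws `T` and `a ≥ 0`: the product weight of the sequences
`ω : Fin T → α` with `|Σ_i F(ω_i) − T·Σ_b w_b F(b)| > a` is at most `2 exp(−a²/(2T))`.
[cite: HuangKuengPreskill2021, SM §'Measuring absolute values' ("we can apply Hoeffding's inequality")] -/
theorem sum_weight_abs_sum_sub_gt_le (w : α → ℝ) (hw : ∀ b, 0 ≤ w b) (hw1 : ∑ b, w b = 1)
    (F : α → ℝ) (hF : ∀ b, |F b| ≤ 1) (T : ℕ) {a : ℝ} (ha : 0 ≤ a) :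
    ∑ ω ∈ univ.filter (fun ω : Fin T → α => a < |∑ i, F (ω i) - T * ∑ b, w b * F b|),
        ∏ i, w (ω i) ≤ 2 * Real.exp (-a ^ 2 / (2 * T)) := by
  classical
  letI : MeasurableSpace α := ⊤
  haveI : MeasurableSingletonClass α := ⟨fun _ => MeasurableSpace.measurableSet_top⟩
  -- one draw: the measure with the weights `w`
  have hsum : ∑ b, ENNReal.ofReal (w b) = 1 := by
    rw [← ENNReal.ofReal_sum_of_nonneg (fun b _ => hw b), hw1, ENNReal.ofReal_one]
  set p : PMF α := PMF.ofFintype (fun b => ENNReal.ofReal (w b)) hsum with hp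
  set μ : Measure α := p.toMeasure with hμ
  have hμa : ∀ b : α, μ {b} = ENNReal.ofReal (w b) := fun b => by
    rw [hμ, p.toMeasure_apply_singleton b (measurableSet_singleton b), hp, PMF.ofFintype_apply]
  have hsing : ∀ b : α, μ.real {b} = w b := fun b => by
    rw [measureReal_def, hμa, ENNReal.toReal_ofReal (hw b)]
  set m : ℝ := ∑ b, w b * F b with hm
  have hFmeas : Measurable F := measurable_of_finite F
  have hFbdd : ∀ᵐ b ∂μ, F b ∈ Set.Icc (-1 : ℝ) 1 :=
    ae_of_all _ fun b => Set.mem_Icc.mpr (abs_le.mp (hF b))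
  have hFint : Integrable F μ := Integrable.of_mem_Icc (-1) 1 hFmeas.aemeasurable hFbdd
  have hmean : μ[F] = m := by
    rw [integral_fintype hFint]
    simp only [hsing, smul_eq_mul, hm]
  -- `T` independent draws
  set P : Measure (Fin T → α) := Measure.pi fun _ : Fin T => μ with hP
  have hXmeas : ∀ i : Fin T, Measurable fun ω : Fin T → α => F (ω i) :=
    fun i => hFmeas.comp (measurable_pi_apply i)
  have hint : ∀ i : Fin T, ∫ ω, F (ω i) ∂P = m := fun i => by
    have hmp := measurePreserving_eval (fun _ : Fin T => μ) i
    rw [← hmean, ← hmp.map_eq, integral_map (measurable_pi_apply i).aemeasurable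
      hFmeas.aestronglyMeasurable]
  have hind : iIndepFun (fun (i : Fin T) (ω : Fin T → α) => F (ω i)) P := by
    rw [hP]
    exact iIndepFun_pi (X := fun _ : Fin T => F) fun _ => hFmeas.aemeasurable
  -- the centred coordinates are sub-Gaussian with parameter `((1 − (−1))/2)² = 1` (Hoeffding's lemma)
  have hsub : ∀ i ∈ (univ : Finset (Fin T)),
      HasSubgaussianMGF (fun ω : Fin T → α => F (ω i) - m) ((‖(1 : ℝ) - -1‖₊ / 2) ^ 2) P := by
    intro i _
    have h := hasSubgaussianMGF_of_mem_Icc (μ := P) (X := fun ω : Fin T → α => F (ω i))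
      (a := -1) (b := 1) (hXmeas i).aemeasurable (ae_of_all _ fun ω => Set.mem_Icc.mpr (abs_le.mp (hF (ω i))))
    rw [hint i] at h
    exact h
  have hsub' : ∀ i ∈ (univ : Finset (Fin T)),
      HasSubgaussianMGF (fun ω : Fin T → α => -(F (ω i) - m)) ((‖(1 : ℝ) - -1‖₊ / 2) ^ 2) P :=
    fun i hi => (hsub i hi).neg
  have hindY : iIndepFun (fun (i : Fin T) (ω : Fin T → α) => F (ω i) - m) P :=
    hind.comp (fun _ (x : ℝ) => x - m) (fun _ => measurable_id.sub_const _)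
  have hindY' : iIndepFun (fun (i : Fin T) (ω : Fin T → α) => -(F (ω i) - m)) P :=
    hind.comp (fun _ (x : ℝ) => -(x - m)) (fun _ => (measurable_id.sub_const _).neg)
  have hcsum : ((∑ i ∈ (univ : Finset (Fin T)), ((‖(1 : ℝ) - -1‖₊ / 2) ^ 2 : ℝ≥0) : ℝ≥0) : ℝ) = T := by
    rw [NNReal.coe_sum]
    have h1 : (((‖(1 : ℝ) - -1‖₊ / 2) ^ 2 : ℝ≥0) : ℝ) = 1 := by
      rw [NNReal.coe_pow, NNReal.coe_div, coe_nnnorm, Real.norm_eq_abs, NNReal.coe_ofNat]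
      norm_num
    simp only [h1, sum_const, card_univ, Fintype.card_fin, nsmul_eq_mul, mul_one]
  have hexp : -a ^ 2 / (2 * ((∑ i ∈ (univ : Finset (Fin T)), ((‖(1 : ℝ) - -1‖₊ / 2) ^ 2 : ℝ≥0) : ℝ≥0) : ℝ))
      = -a ^ 2 / (2 * T) := by rw [hcsum]
  have hup : P.real {ω | a ≤ ∑ i ∈ (univ : Finset (Fin T)), (F (ω i) - m)} ≤ Real.exp (-a ^ 2 / (2 * T)) := by
    have h1 := HasSubgaussianMGF.measure_sum_ge_le_of_iIndepFun hindY hsub ha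
    rwa [hexp] at h1
  have hlo : P.real {ω | a ≤ ∑ i ∈ (univ : Finset (Fin T)), -(F (ω i) - m)} ≤ Real.exp (-a ^ 2 / (2 * T)) := by
    have h1 := HasSubgaussianMGF.measure_sum_ge_le_of_iIndepFun hindY' hsub' ha
    rwa [hexp] at h1
  -- the event lies inside the union of the two one-sided tails
  set B : Finset (Fin T → α) :=
    univ.filter fun ω : Fin T → α => a < |∑ i, F (ω i) - T * m| with hB
  have hcentre : ∀ ω : Fin T → α, ∑ i, F (ω i) - T * m = ∑ i, (F (ω i) - m) := fun ω => by
    rw [sum_sub_distrib, sum_const, card_univ, Fintype.card_fin, nsmul_eq_mul]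
  have hsubset : (B : Set (Fin T → α)) ⊆
      {ω | a ≤ ∑ i ∈ (univ : Finset (Fin T)), (F (ω i) - m)} ∪
        {ω | a ≤ ∑ i ∈ (univ : Finset (Fin T)), -(F (ω i) - m)} := by
    intro ω hω
    rw [Finset.mem_coe, hB, Finset.mem_filter] at hω
    simp only [Set.mem_setOf_eq, Set.mem_union]
    have h := hω.2
    rw [hcentre ω] at h
    rw [sum_neg_distrib]
    rcases le_or_gt 0 (∑ i, (F (ω i) - m)) with h0 | h0
    · left; rw [abs_of_nonneg h0] at h; exact h.le
    · right; rw [abs_of_neg h0] at h; exact h.le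
  have h2 : 0 ≤ Real.exp (-a ^ 2 / (2 * T)) := (Real.exp_pos _).le
  have hPB : P B ≤ ENNReal.ofReal (2 * Real.exp (-a ^ 2 / (2 * T))) := by
    calc P B ≤ P ({ω | a ≤ ∑ i ∈ (univ : Finset (Fin T)), (F (ω i) - m)} ∪
            {ω | a ≤ ∑ i ∈ (univ : Finset (Fin T)), -(F (ω i) - m)}) := measure_mono hsubset
      _ ≤ P {ω | a ≤ ∑ i ∈ (univ : Finset (Fin T)), (F (ω i) - m)} +
            P {ω | a ≤ ∑ i ∈ (univ : Finset (Fin T)), -(F (ω i) - m)} := measure_union_le _ _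
      _ = ENNReal.ofReal (P.real {ω | a ≤ ∑ i ∈ (univ : Finset (Fin T)), (F (ω i) - m)}) +
            ENNReal.ofReal (P.real {ω | a ≤ ∑ i ∈ (univ : Finset (Fin T)), -(F (ω i) - m)}) := by
          rw [ofReal_measureReal, ofReal_measureReal]
      _ ≤ ENNReal.ofReal (Real.exp (-a ^ 2 / (2 * T))) + ENNReal.ofReal (Real.exp (-a ^ 2 / (2 * T))) :=
          add_le_add (ENNReal.ofReal_le_ofReal hup) (ENNReal.ofReal_le_ofReal hlo)
      _ = ENNReal.ofReal (2 * Real.exp (-a ^ 2 / (2 * T))) := by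
          rw [← ENNReal.ofReal_add h2 h2]; congr 1; ring
  -- read the product measure of `B` as the product weight
  have hPB' : P B = ENNReal.ofReal (∑ ω ∈ B, ∏ i, w (ω i)) := by
    rw [← sum_measure_singleton, ENNReal.ofReal_sum_of_nonneg
      (fun ω _ => Finset.prod_nonneg fun i _ => hw (ω i))]
    refine Finset.sum_congr rfl fun ω _ => ?_
    rw [hP, Measure.pi_singleton, ENNReal.ofReal_prod_of_nonneg (fun i _ => hw (ω i))]
    exact Finset.prod_congr rfl fun i _ => hμa (ω i)
  rw [hPB'] at hPB
  have hrhs : 0 ≤ 2 * Real.exp (-a ^ 2 / (2 * T)) := by positivity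
  exact (ENNReal.ofReal_le_ofReal_iff hrhs).mp hPB

end Hoeffding

/-! ### The Bell-sampling instance: Lemma 3 of Huang–Kueng–Preskill -/

variable {ι : Type*} [Fintype ι] [DecidableEq ι]

/-- The **Bell-sampling weight** of the label `b` on two copies of `ρ`: `w_b = Re Tr(Φ_b(ρ ⊗ ρ))`
(the outcome probability; the trace is real for Hermitian `ρ`, `trace_bellBasis_two_copies_im`).
[cite: HuangKuengPreskill2021, SM §'Measuring absolute values' ("the distribution of Bell measurement outcomes")] -/
def bellWeight (ρ : Matrix (ι → Bool) (ι → Bool) ℂ) (T : ι → Pauli) : ℝ :=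
  ((bellBasis T * (ρ ⊗ₖ ρ)).trace).re

/-- Unfolding of `bellWeight`. [cite: HuangKuengPreskill2021, SM §'Measuring absolute values'] -/
theorem bellWeight_eq (ρ : Matrix (ι → Bool) (ι → Bool) ℂ) (T : ι → Pauli) :
    bellWeight ρ T = ((bellBasis T * (ρ ⊗ₖ ρ)).trace).re := rfl

/-- The **real `±1` statistic** `ε(a,b) = ySign a · (−1)^{⟨a,b⟩}` — the printed
`∏_k Tr((σ_k ⊗ σ_k) S_k)` — as a real number. [cite: HuangKuengPreskill2021, SM §'Measuring absolute values' ("∏_k Tr((σ_k⊗σ_k)S_k) = ±1")] -/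
def bellSignℝ (S T : ι → Pauli) : ℝ := (ySign S * strSign S T).re

omit [DecidableEq ι] in
/-- `ε(a,b)` is the real number `bellSignℝ a b`. [cite: HuangKuengPreskill2021, SM §'Measuring absolute values'] -/
theorem bellSign_eq_ofReal (S T : ι → Pauli) : ySign S * strSign S T = (bellSignℝ S T : ℂ) := by
  rcases bellSign_eq_one_or S T with h | h <;> simp [bellSignℝ, h]

omit [DecidableEq ι] in
/-- `ε(a,b) ∈ {±1}` (real form). [cite: HuangKuengPreskill2021, SM §'Measuring absolute values'] -/
theorem bellSignℝ_eq_one_or (S T : ι → Pauli) : bellSignℝ S T = 1 ∨ bellSignℝ S T = -1 := by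
  rcases bellSign_eq_one_or S T with h | h <;> simp [bellSignℝ, h]

omit [DecidableEq ι] in
/-- `|ε(a,b)| ≤ 1`. [cite: HuangKuengPreskill2021, SM §'Measuring absolute values'] -/
theorem abs_bellSignℝ_le_one (S T : ι → Pauli) : |bellSignℝ S T| ≤ 1 := by
  rcases bellSignℝ_eq_one_or S T with h | h <;> simp [h]

omit [DecidableEq ι] in
/-- `Φ⁺` is Hermitian. [cite: Montanaro2017BellSampling, §2] -/
theorem conjTranspose_bellState :
    (bellState : Matrix ((ι → Bool) × (ι → Bool)) ((ι → Bool) × (ι → Bool)) ℂ)ᴴ = bellState := by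
  ext x y
  rw [Matrix.conjTranspose_apply, bellState_apply, bellState_apply]
  by_cases h : y.1 = y.2 ∧ x.1 = x.2
  · rw [if_pos h, if_pos (And.intro h.2 h.1)]
    simp
  · rw [if_neg h, if_neg (fun h' => h (And.intro h'.2 h'.1)), star_zero]

/-- Each Bell projector is Hermitian: `Φ_bᴴ = Φ_b`. [cite: Montanaro2017BellSampling, §2] -/
theorem conjTranspose_bellBasis (T : ι → Pauli) : (bellBasis T)ᴴ = bellBasis T := by
  rw [bellBasis_eq, Matrix.conjTranspose_mul, Matrix.conjTranspose_mul, conjTranspose_bellState,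
    Matrix.conjTranspose_kronecker, conjTranspose_pauliString, Matrix.conjTranspose_one,
    Matrix.mul_assoc]

/-- `Tr(Φ_b X)` is real for Hermitian `X`. [cite: Montanaro2017BellSampling, Lemma 2 (a probability)] -/
theorem star_trace_bellBasis_mul
    {X : Matrix ((ι → Bool) × (ι → Bool)) ((ι → Bool) × (ι → Bool)) ℂ} (hX : Xᴴ = X)
    (T : ι → Pauli) : star (bellBasis T * X).trace = (bellBasis T * X).trace := by
  rw [← Matrix.trace_conjTranspose, Matrix.conjTranspose_mul, hX, conjTranspose_bellBasis,
    Matrix.trace_mul_comm]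

/-- For Hermitian `ρ` every Bell weight is a real number: `Im Tr(Φ_b(ρ⊗ρ)) = 0`.
[cite: Montanaro2017BellSampling, Lemma 2 (a probability)] -/
theorem trace_bellBasis_two_copies_im {ρ : Matrix (ι → Bool) (ι → Bool) ℂ} (hρ : ρᴴ = ρ)
    (T : ι → Pauli) : ((bellBasis T * (ρ ⊗ₖ ρ)).trace).im = 0 := by
  have hX : (ρ ⊗ₖ ρ)ᴴ = ρ ⊗ₖ ρ := by rw [Matrix.conjTranspose_kronecker, hρ]
  have h := congrArg Complex.im (star_trace_bellBasis_mul hX T)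
  rw [Complex.star_def, Complex.conj_im] at h
  linarith

/-- The Bell weights of two copies sum to `(Re Tr ρ)²` (`= 1` for a state).
[cite: HuangKuengPreskill2021, SM §'Measuring absolute values'] [cite: Montanaro2017BellSampling, Lemma 2] -/
theorem sum_bellWeight {ρ : Matrix (ι → Bool) (ι → Bool) ℂ} (hρ : ρᴴ = ρ) :
    ∑ T, bellWeight ρ T = (ρ.trace).re ^ 2 := by
  simp only [bellWeight_eq]
  rw [← Complex.re_sum, sum_trace_bellBasis_mul_kronecker, Complex.mul_re]
  have him : (ρ.trace).im = 0 := by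
    have h := congrArg Complex.im (Matrix.trace_conjTranspose ρ)
    rw [hρ, Complex.star_def, Complex.conj_im] at h
    linarith
  rw [him, mul_zero, sub_zero, sq]

/-- For a state (`ρᴴ = ρ`, `Tr ρ = 1`) the Bell weights sum to one.
[cite: Montanaro2017BellSampling, Lemma 2] -/
theorem sum_bellWeight_eq_one {ρ : Matrix (ι → Bool) (ι → Bool) ℂ} (hρ : ρᴴ = ρ) (htr : ρ.trace = 1) :
    ∑ T, bellWeight ρ T = 1 := by
  rw [sum_bellWeight hρ, htr, Complex.one_re, one_pow]

/-- **The real form of (bell-expected)**: `E_w[ε(a,·)] = Σ_b w_b ε(a,b) = (Re Tr(P_aρ))² = |Tr(P_aρ)|²`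
for Hermitian `ρ`. [cite: HuangKuengPreskill2021, SM §'Measuring absolute values', eq. (bell-expected)]
[cite: HuangEtAl2022Science, SM §'Prediction phase', eq. (bell-expected)] -/
theorem sum_bellWeight_mul_bellSignℝ {ρ : Matrix (ι → Bool) (ι → Bool) ℂ} (hρ : ρᴴ = ρ)
    (S : ι → Pauli) :
    ∑ T, bellWeight ρ T * bellSignℝ S T = ((pauliString S * ρ).trace).re ^ 2 := by
  have key := sum_bellSign_mul_trace_bellBasis_two_copies S ρ
  have hterm : ∀ T, ((ySign S * strSign S T) * (bellBasis T * (ρ ⊗ₖ ρ)).trace).re =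
      bellWeight ρ T * bellSignℝ S T := by
    intro T
    rw [bellSign_eq_ofReal, Complex.re_ofReal_mul, bellWeight_eq, mul_comm]
  have h := congrArg Complex.re key
  rw [Complex.re_sum] at h
  simp only [hterm] at h
  rw [h, sq, sq, Complex.mul_re]
  have him : ((pauliString S * ρ).trace).im = 0 := by
    have h2 := congrArg Complex.im (star_trace_pauliString_mul hρ S)
    rw [Complex.star_def, Complex.conj_im] at h2
    linarith
  rw [him, mul_zero, sub_zero]

/-- **Lemma 3 of Huang–Kueng–Preskill as a tail bound.**  Let `ρ` be Hermitian with Bell weights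
`w_b = Tr(Φ_b(ρ⊗ρ)) ≥ 0` summing to one (a state).  Bell-measure `N` independent pairs of copies,
outcomes `b_1, …, b_N`, and form `â(a) = (1/N) Σ_t ε(a, b_t)` for a Pauli string `a`.  Then the
probability (product weight of the outcome records) that `|â(a) − |Tr(P_aρ)|²| > ε` is at most
`2 exp(−Nε²/2)`; here the event is written as `εN < |Σ_t ε(a,b_t) − N·|Tr(P_aρ)|²|`, and `ρ` is
entered through `ρᴴ = ρ`, `Tr ρ = 1` and the nonnegativity of its Bell weights (which holds for
every density matrix: `Tr(Φ_b(ρ⊗ρ)) = ⟨Φ_b|ρ⊗ρ|Φ_b⟩ ≥ 0`).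
[cite: HuangKuengPreskill2021, SM §'Measuring absolute values', Lemma 3] [cite: HuangEtAl2022Science, SM §'Prediction phase', Lemma 1] -/
theorem bellEstimate_tail {ρ : Matrix (ι → Bool) (ι → Bool) ℂ} (hρ : ρᴴ = ρ) (htr : ρ.trace = 1)
    (hw : ∀ T, 0 ≤ bellWeight ρ T) (S : ι → Pauli) (N : ℕ) {ε : ℝ} (hε : 0 ≤ ε) :
    ∑ ω ∈ univ.filter (fun ω : Fin N → (ι → Pauli) =>
        ε * N < |∑ t, bellSignℝ S (ω t) - N * ((pauliString S * ρ).trace).re ^ 2|),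
      ∏ t, bellWeight ρ (ω t) ≤ 2 * Real.exp (-(N * ε ^ 2) / 2) := by
  have h := sum_weight_abs_sum_sub_gt_le (bellWeight ρ) hw (sum_bellWeight_eq_one hρ htr)
    (bellSignℝ S) (abs_bellSignℝ_le_one S) N (a := ε * N) (by positivity)
  rw [sum_bellWeight_mul_bellSignℝ hρ S] at h
  have hexp : -(ε * N) ^ 2 / (2 * (N : ℝ)) = -(N * ε ^ 2) / 2 := by
    rcases eq_or_ne ((N : ℝ)) 0 with hN | hN
    · rw [hN]; simp
    · field_simp
  rw [hexp] at h
  exact h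


/-- For a density matrix the Bell weights are nonnegative (`Tr(Φ_b(ρ⊗ρ)) = ⟨Φ_b|ρ⊗ρ|Φ_b⟩ ≥ 0`,
`TwoCopyBellSampling.trace_bellBasis_mul_kronecker_nonneg`). [cite: Montanaro2017BellSampling, Lemma 2 (a probability)] -/
theorem bellWeight_nonneg {ρ : Matrix (ι → Bool) (ι → Bool) ℂ} (hρ : ρ.PosSemidef) (T : ι → Pauli) :
    0 ≤ bellWeight ρ T := by
  have h := trace_bellBasis_mul_kronecker_nonneg hρ hρ T
  rw [bellWeight_eq]
  exact (Complex.nonneg_iff.mp h).1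

/-- **Lemma 3 for a density matrix** (`ρ ⪰ 0`, `Tr ρ = 1`): the weight of the `N`-outcome Bell
records with `|â(a) − |Tr(P_aρ)|²| > ε` is at most `2 exp(−Nε²/2)`.
[cite: HuangKuengPreskill2021, SM §'Measuring absolute values', Lemma 3] [cite: HuangEtAl2022Science, SM §'Prediction phase', Lemma 1] -/
theorem bellEstimate_tail_state {ρ : Matrix (ι → Bool) (ι → Bool) ℂ} (hρ : ρ.PosSemidef)
    (htr : ρ.trace = 1) (S : ι → Pauli) (N : ℕ) {ε : ℝ} (hε : 0 ≤ ε) :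
    ∑ ω ∈ univ.filter (fun ω : Fin N → (ι → Pauli) =>
        ε * N < |∑ t, bellSignℝ S (ω t) - N * ((pauliString S * ρ).trace).re ^ 2|),
      ∏ t, bellWeight ρ (ω t) ≤ 2 * Real.exp (-(N * ε ^ 2) / 2) :=
  bellEstimate_tail hρ.1 htr (bellWeight_nonneg hρ) S N hε

/-- **The printed sample count**: the tail bound `2 exp(−Nε²/2)` is `≤ δ` exactly when
`N ≥ 2 log(2/δ)/ε²` — "`N₁ = Θ(log(1/δ)/ε²)`". [cite: HuangKuengPreskill2021, SM §'Measuring absolute values', Lemma 3]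
[cite: HuangEtAl2022Science, SM §'Prediction phase', Lemma 1] -/
theorem bellEstimate_tail_le_delta_iff {N ε δ : ℝ} (hε : 0 < ε) (hδ : 0 < δ) :
    2 * Real.exp (-(N * ε ^ 2) / 2) ≤ δ ↔ 2 * Real.log (2 / δ) / ε ^ 2 ≤ N := by
  have h := DFE.settings_hoeffding (ℓ := N) hε hδ one_pos
  simp only [one_pow, mul_one, one_mul] at h
  exact h


/-! ### From `â` to `b̂ = √max(0, â)`: the estimate of `|Tr(Pρ)|` itself (Corollary 1) -/

/-- **The printed implication behind Corollary 1**: with `b̂ = √max(0, â)`,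
`|Tr(Pρ)|² − ε ≤ â ≤ |Tr(Pρ)|² + ε ⟹ ||Tr(Pρ)| − √ε|₊ ≤ b̂ ≤ |Tr(Pρ)| + √ε`, i.e.
`|b̂ − |Tr(Pρ)|| ≤ √ε`; here for any real `x` in place of `Tr(Pρ)` (`t = x²`).  Hence Lemma 3 at
accuracy `ε²` gives `|b̂ − |Tr(Pρ)|| ≤ ε` with `N₁ = Θ(log(1/δ)/ε⁴)` samples (Corollary 1).
[cite: HuangKuengPreskill2021, SM §'Measuring absolute values', the display before Corollary 1 and Corollary 1] -/
theorem abs_sqrt_max_sub_abs_le {ahat x ε : ℝ} (h : |ahat - x ^ 2| ≤ ε) :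
    abs (Real.sqrt (max 0 ahat) - |x|) ≤ Real.sqrt ε := by
  have ht : 0 ≤ x ^ 2 := sq_nonneg x
  have hclamp : |max 0 ahat - x ^ 2| ≤ |ahat - x ^ 2| := by
    rcases le_total 0 ahat with h0 | h0
    · rw [max_eq_right h0]
    · rw [max_eq_left h0, zero_sub, abs_neg, abs_of_nonneg ht, abs_sub_comm,
        abs_of_nonneg (by linarith)]
      linarith
  calc abs (Real.sqrt (max 0 ahat) - |x|)
      = |Real.sqrt (max 0 ahat) - Real.sqrt (x ^ 2)| := by rw [Real.sqrt_sq_eq_abs]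
    _ ≤ Real.sqrt |max 0 ahat - x ^ 2| :=
        Literature.Computability.Cryptography.abs_sqrt_sub_sqrt_le (le_max_left _ _) ht
    _ ≤ Real.sqrt |ahat - x ^ 2| := Real.sqrt_le_sqrt hclamp
    _ ≤ Real.sqrt ε := Real.sqrt_le_sqrt h

/-! ### All `M` observables at once: Lemma 3 / Corollary 1 with the union bound
(SM §*Sample complexity analysis*: "following Corollary 1 and the union bound, we choose
`N₁ = Θ(log(M/δ)/ε⁴)` such that with probability at least `1 − δ/2`, we have
`|b̂_i − |Tr(P_iρ)|| ≤ ε/3, ∀ i = 1, …, M`") -/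

section UnionBound

variable {X : Type*} [Fintype X]

/-- **Union bound over a finite family of events, for nonnegative weights**: the weight of
`{x | ∃ a ∈ A, E a x}` is at most `Σ_{a ∈ A}` (weight of `{x | E a x}`).
[cite: HuangKuengPreskill2021, SM §'Sample complexity analysis' ("and the union bound")] -/
theorem sum_filter_exists_mem_le (f : X → ℝ) (hf : ∀ x, 0 ≤ f x) {γ : Type*} (A : Finset γ)
    (E : γ → X → Prop) [∀ a, DecidablePred (E a)] [DecidablePred fun x => ∃ a ∈ A, E a x] :
    ∑ x ∈ univ.filter (fun x => ∃ a ∈ A, E a x), f x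
      ≤ ∑ a ∈ A, ∑ x ∈ univ.filter (E a), f x := by
  classical
  have hR : ∑ a ∈ A, ∑ x ∈ univ.filter (E a), f x = ∑ x, ∑ a ∈ A, if E a x then f x else 0 := by
    simp_rw [sum_filter]
    rw [sum_comm]
  rw [hR, sum_filter]
  refine sum_le_sum fun x _ => ?_
  split_ifs with h
  · obtain ⟨a, haA, hax⟩ := h
    calc f x = if E a x then f x else 0 := by rw [if_pos hax]
      _ ≤ ∑ a ∈ A, if E a x then f x else 0 :=
          single_le_sum (f := fun a => if E a x then f x else 0)
            (fun b _ => by split_ifs <;> simp [hf x]) haA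
  · exact sum_nonneg fun a _ => by split_ifs <;> simp [hf x]

end UnionBound

/-- For Hermitian `ρ`, `Tr(P_aρ)` is real, so `|Tr(P_aρ)| = |Re Tr(P_aρ)|` (the modulus entering
Corollary 1 is the absolute value of the real number `Re Tr(P_aρ)` used throughout this file).
[cite: HuangKuengPreskill2021, SM §'Measuring absolute values'] -/
theorem norm_trace_pauliString_mul_eq_abs_re {ρ : Matrix (ι → Bool) (ι → Bool) ℂ} (hρ : ρᴴ = ρ)
    (S : ι → Pauli) : ‖(pauliString S * ρ).trace‖ = |((pauliString S * ρ).trace).re| := by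
  have him : ((pauliString S * ρ).trace).im = 0 := by
    have h2 := congrArg Complex.im (star_trace_pauliString_mul hρ S)
    rw [Complex.star_def, Complex.conj_im] at h2
    linarith
  rw [← Complex.re_add_im ((pauliString S * ρ).trace), him]
  simp [Complex.norm_real]

/-- **Lemma 3 for `M` Pauli strings simultaneously (union bound).**  For a Hermitian trace-one
`ρ` with nonnegative Bell weights, a finite set `A` of Pauli strings (`M = |A|`), `N` Bell samples
and `ε ≥ 0`: the weight of the outcome records for which SOME `a ∈ A` has
`|â(a) − |Tr(P_aρ)|²| > ε` is at most `M · 2 exp(−Nε²/2)`.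
[cite: HuangKuengPreskill2021, SM §'Measuring absolute values', Lemma 3 + §'Sample complexity analysis' (union bound)]
[cite: HuangEtAl2022Science, SM §'Prediction phase', Lemma 1] -/
theorem bellEstimate_tail_union {ρ : Matrix (ι → Bool) (ι → Bool) ℂ} (hρ : ρᴴ = ρ)
    (htr : ρ.trace = 1) (hw : ∀ T, 0 ≤ bellWeight ρ T) (A : Finset (ι → Pauli)) (N : ℕ)
    {ε : ℝ} (hε : 0 ≤ ε) :
    ∑ ω ∈ univ.filter (fun ω : Fin N → (ι → Pauli) => ∃ S ∈ A,
        ε * N < |∑ t, bellSignℝ S (ω t) - N * ((pauliString S * ρ).trace).re ^ 2|),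
      ∏ t, bellWeight ρ (ω t) ≤ A.card * (2 * Real.exp (-(N * ε ^ 2) / 2)) := by
  classical
  refine (sum_filter_exists_mem_le _ (fun ω => prod_nonneg fun t _ => hw (ω t)) A _).trans ?_
  calc ∑ S ∈ A, ∑ ω ∈ univ.filter (fun ω : Fin N → (ι → Pauli) =>
          ε * N < |∑ t, bellSignℝ S (ω t) - N * ((pauliString S * ρ).trace).re ^ 2|),
          ∏ t, bellWeight ρ (ω t)
      ≤ ∑ S ∈ A, 2 * Real.exp (-(N * ε ^ 2) / 2) :=
        sum_le_sum fun S _ => bellEstimate_tail hρ htr hw S N hε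
    _ = A.card * (2 * Real.exp (-(N * ε ^ 2) / 2)) := by rw [sum_const, nsmul_eq_mul]

/-- **Lemma 3 for `M` Pauli strings simultaneously, density-matrix form** (`ρ ⪰ 0`, `Tr ρ = 1`).
[cite: HuangKuengPreskill2021, SM §'Measuring absolute values', Lemma 3 + §'Sample complexity analysis' (union bound)]
[cite: HuangEtAl2022Science, SM §'Prediction phase', Lemma 1] -/
theorem bellEstimate_tail_union_state {ρ : Matrix (ι → Bool) (ι → Bool) ℂ} (hρ : ρ.PosSemidef)
    (htr : ρ.trace = 1) (A : Finset (ι → Pauli)) (N : ℕ) {ε : ℝ} (hε : 0 ≤ ε) :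
    ∑ ω ∈ univ.filter (fun ω : Fin N → (ι → Pauli) => ∃ S ∈ A,
        ε * N < |∑ t, bellSignℝ S (ω t) - N * ((pauliString S * ρ).trace).re ^ 2|),
      ∏ t, bellWeight ρ (ω t) ≤ A.card * (2 * Real.exp (-(N * ε ^ 2) / 2)) :=
  bellEstimate_tail_union hρ.1 htr (bellWeight_nonneg hρ) A N hε

/-- **The printed sample count with `M` observables**: `M · 2 exp(−Nε²/2) ≤ δ` exactly when
`N ≥ 2 log(2M/δ)/ε²` — "`N = Θ(log(M/δ)/ε²)`" for the squares `|Tr(P_iρ)|²`.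
[cite: HuangKuengPreskill2021, SM §'Sample complexity analysis'] [cite: HuangEtAl2022Science, SM §'Prediction phase' (N = O(log(M/δ)/ε⁴))] -/
theorem bellEstimate_tail_union_le_delta_iff {M N ε δ : ℝ} (hM : 0 < M) (hε : 0 < ε) (hδ : 0 < δ) :
    M * (2 * Real.exp (-(N * ε ^ 2) / 2)) ≤ δ ↔ 2 * Real.log (2 * M / δ) / ε ^ 2 ≤ N := by
  have h := bellEstimate_tail_le_delta_iff (N := N) hε (div_pos hδ hM)
  rw [mul_comm, ← le_div_iff₀ hM, h, div_div_eq_mul_div]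

/-- **Corollary 1 for `M` Pauli strings simultaneously** (the statement of SM §*Sample complexity
analysis*): with `b̂(a) = √max(0, â(a))`, `â(a) = (1/N) Σ_t ε(a, b_t)`, the weight of the `N`-sample
Bell records (`N ≥ 1`) for which SOME `a ∈ A` has `|b̂(a) − |Tr(P_aρ)|| > √ε` is at most
`M · 2 exp(−Nε²/2)` — so accuracy `η` for all `M` moduli costs `N = 2 log(2M/δ)/η⁴` samples
(`ε = η²`; `bellAbsEstimate_count`).  Deterministic step: `abs_sqrt_max_sub_abs_le`.
[cite: HuangKuengPreskill2021, SM §'Measuring absolute values', Corollary 1 + §'Sample complexity analysis', eq. (N₁ = Θ(log(M/δ)/ε⁴))] -/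
theorem bellAbsEstimate_tail_union_state {ρ : Matrix (ι → Bool) (ι → Bool) ℂ}
    (hρ : ρ.PosSemidef) (htr : ρ.trace = 1) (A : Finset (ι → Pauli)) {N : ℕ} (hN : 0 < N)
    {ε : ℝ} (hε : 0 ≤ ε) :
    ∑ ω ∈ univ.filter (fun ω : Fin N → (ι → Pauli) => ∃ S ∈ A,
        Real.sqrt ε < abs (Real.sqrt (max 0 ((∑ t, bellSignℝ S (ω t)) / N))
          - |((pauliString S * ρ).trace).re|)),
      ∏ t, bellWeight ρ (ω t) ≤ A.card * (2 * Real.exp (-(N * ε ^ 2) / 2)) := by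
  classical
  refine le_trans ?_ (bellEstimate_tail_union_state hρ htr A N hε)
  apply sum_le_sum_of_subset_of_nonneg
  · intro ω hω
    simp only [mem_filter, mem_univ, true_and] at hω ⊢
    obtain ⟨S, hSA, hS⟩ := hω
    refine ⟨S, hSA, ?_⟩
    have hNr : (0 : ℝ) < N := by exact_mod_cast hN
    set x : ℝ := ((pauliString S * ρ).trace).re
    set s : ℝ := ∑ t, bellSignℝ S (ω t)
    by_contra hle
    push Not at hle
    have hsmall : |s / N - x ^ 2| ≤ ε := by
      rw [abs_le] at *
      have h1 : s / N - x ^ 2 = (s - N * x ^ 2) / N := by field_simp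
      rw [h1]
      constructor
      · rw [le_div_iff₀ hNr]; linarith [hle.1]
      · rw [div_le_iff₀ hNr]; linarith [hle.2]
    exact absurd (abs_sqrt_max_sub_abs_le hsmall) (not_le.mpr hS)
  · intro ω _ _
    exact prod_nonneg fun t _ => bellWeight_nonneg hρ (ω t)

/-- **The printed `N₁ = Θ(log(M/δ)/ε⁴)`**: at target accuracy `η > 0` for the moduli
(`ε = η²` in `bellAbsEstimate_tail_union_state`), the failure bound `M · 2 exp(−Nη⁴/2)` is `≤ δ`
exactly when `N ≥ 2 log(2M/δ)/η⁴`.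
[cite: HuangKuengPreskill2021, SM §'Sample complexity analysis', eq. (N₁ = Θ(log(M/δ)/ε⁴))]
[cite: HuangEtAl2022Science, SM §'Prediction phase' (N = O(log(M/δ)/ε⁴))] -/
theorem bellAbsEstimate_count {M N η δ : ℝ} (hM : 0 < M) (hη : 0 < η) (hδ : 0 < δ) :
    M * (2 * Real.exp (-(N * (η ^ 2) ^ 2) / 2)) ≤ δ ↔ 2 * Real.log (2 * M / δ) / η ^ 4 ≤ N := by
  rw [bellEstimate_tail_union_le_delta_iff hM (pow_pos hη 2) hδ]
  norm_num [← pow_mul]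

end Literature.InformationTheory.QuantumLearning.BellSampling
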